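import Summits.ValiantsHypothesis.ValiantsHypothesis.Theorems.TwoProducts.RankThreeAffineSeparated

/-!
# Rank three AFFINE, the UNIT LADDER: `Σₖ Uₖ·Cₖ` with TAME units and SPARSE coefficients has few edge directions — by induction on the number of terms

ENGINE (carrier-count-free) for the located class «bounded fewnomials» (T1-E) of the OPEN rung 3-AFF of the SIDE ladder «table-rank-ladder» of crux
`stmt-ValiantsHypothesis-5906` (`TwoProducts`) — val-port-1 g5; priced by val-idea-crit-8 g5 VERDICT #79 (conditions (E1)–(E7)).
KEY REMARK.  ✓ `shiftedAxialTransfer` needs only a UNIQUE TOP of the multiplier `G` (no sparsity); ✓ `card_SpecShift_le'` charges `|Xc σ v| + |Eset σ G|`;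
✓ `uniqueTop_of_not_mem_Eset` needs only `G ≠ 0`.  So the multiplier may be any TAME polynomial.  A UNIT is a nonzero `U` with a sparse
log-derivative numerator, `M·J(U,v) = U·L` (`M ≠ 0` fixed, `L` sparse) and few edge directions `|Eset σ U| ≤ η` — e.g. `U = w₀^a·w₁^b·w₂^d` with
`M = w₀w₁w₂`, `L = a·w₁w₂·J(w₀,v) + b·w₀w₂·J(w₁,v) + d·w₀w₁·J(w₂,v)`, `η = 3t²` (✓ `ostrowski`).
ONE STEP (`ladder_step_identity`): for `E = Σ_{k∈K} Uₖ·Cₖ` and a pivot `p ∈ K`, `G := U_p·C_p`,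
`M·(G·J(E,v) − E·J(G,v)) = U_p · Σ_{k∈K∖p} Uₖ·(C_p·Cₖ′ − Cₖ·C_p′)`, `Cₖ′ := Cₖ·Lₖ + M·J(Cₖ,v)` — the `k = p` term cancels identically, the new coefficients are
again SPARSE (`newCoeff`, `card_support_newCoeff_le : ≤ 2s²(ℓ + μt)`), one unit fewer; so ✓ `Eset_subset_of_shifted` (F' := U_p, Br := the shorter sum) and induction give
★★ `card_Eset_unitSum_le : |Eset σ (Σ_{k∈K} Uₖ·Cₖ)| ≤ ladderBound t μ ℓ η |K| s` with the explicit primitive-recursive tower `ladderBound`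
(`ladderBound … (n+1) s = 3(t²+t) + 4η + 3s² + 2 + ladderBound … n (2s²(ℓ+μt))`) — polynomial in `t` for each FIXED number of terms, and honest about
the doubly-exponential growth in the number of terms.
Vocabulary BY IMPORT, nothing restated: the one import ✓ `…RankThreeAffineSeparated` (p707017) is for the bookkeeping name `card_Eset_mul_le` only (gate rule `dedup.landed`,
crit-8 #79 (E5)); through it ✓ `…ShiftedSpecials` (`Eset_subset_of_shifted`, `card_SpecShift_le'`, `SpecShift`), ✓ `…RankThreeAffineTrinomial` (`card_supp_mul_le/_sub_le/_add_le`,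
`card_Eset_le_sq` — bookkeeping only), ✓ `…RankThreeAffineBinomial` (`jac_mul_left`) and the tower (`jac`, `Eset`, `Xc`, `card_Xc_le`, `card_support_jac_le`).
HONEST LABEL: helper ENGINE for a side-ladder located class of the OPEN rung 3-AFF; NOT γ; nothing here closes 5906 / `PlanarCellBound` / `ResidualLawV25`;
`RankThreeAffineLaw(Exp)` / `TwoProducts` UNMOVED (for `m` factors the unit numerators have `~ m·t^{m+1}` terms — no absolute `t`-exponent); 0 summit distance;
VP ≠ VNP is NOT proved here or anywhere in this tree.  `--supports stmt-ValiantsHypothesis-5906 --as helper`.  No instances, no notation, no named facts. [folklore]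
-/

noncomputable section
set_option linter.dupNamespace false

namespace Summit.ValiantsHypothesis.ValiantsHypothesis.Theorems.TwoProducts.RankTwoJacobian

open scoped BigOperators Pointwise Classical
open MvPolynomial

/-! ### §1 The bound tower and the new coefficients -/

/-- The LADDER BOUND: `ladderBound t μ ℓ η n s` bounds `|Eset σ (Σ Uₖ Cₖ)|` for `≤ n` units (`|supp v| ≤ t`, `|supp M| ≤ μ`, numerators `≤ ℓ` terms,
`|Eset Uₖ| ≤ η`) and coefficients with `≤ s` terms; one step costs `3(t²+t) + 4η + 3s² + 2` (`Xc`, `Eset G`, `SpecShift`, `Eset U_p`) and squares the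
coefficient size. -/
def ladderBound (t μ ℓ η : ℕ) : ℕ → ℕ → ℕ
  | 0, _ => 0
  | n + 1, s => 3 * (t * t + t) + 4 * η + 3 * (s * s) + 2 + ladderBound t μ ℓ η n (2 * s * s * (ℓ + μ * t))

/-- the derived coefficient `C′ = C·L + M·J(C,v)` of a term `U·C` (so that `M·J(U·C, v) = U·C′`) -/
def dCoeff (M v L C : Poly2) : Poly2 := C * L + M * jac C v

/-- the NEW coefficient of the unit `Uₖ` after pivoting at `p`: `C_p·Cₖ′ − Cₖ·C_p′` -/
def newCoeff (M v Lp Cp Lk Ck : Poly2) : Poly2 := Cp * dCoeff M v Lk Ck - Ck * dCoeff M v Lp Cp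

/-- `M·J(U·C, v) = U·C′` for a unit `U` (`M·J(U,v) = U·L`). [folklore] -/
theorem unit_jac (M v U L C : Poly2) (hUL : M * jac U v = U * L) : M * jac (U * C) v = U * dCoeff M v L C := by
  unfold dCoeff
  rw [jac_mul_left]
  linear_combination C * hUL

/-- Size of the derived coefficient: `|supp C′| ≤ s·ℓ + μ·(s·t)`. [folklore] -/
theorem card_support_dCoeff_le {M v L C : Poly2} {t μ ℓ s : ℕ} (hvt : v.support.card ≤ t) (hμ : M.support.card ≤ μ)
    (hL : L.support.card ≤ ℓ) (hC : C.support.card ≤ s) : (dCoeff M v L C).support.card ≤ s * ℓ + μ * (s * t) := by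
  unfold dCoeff
  have h1 := (card_supp_mul_le C L).trans (Nat.mul_le_mul hC hL)
  have h2 := (card_supp_mul_le M (jac C v)).trans (Nat.mul_le_mul hμ ((card_support_jac_le C v).trans (Nat.mul_le_mul hC hvt)))
  exact (card_supp_add_le _ _).trans (Nat.add_le_add h1 h2)

/-- Size of the new coefficient: `|supp (C_p·Cₖ′ − Cₖ·C_p′)| ≤ 2s²(ℓ + μt)`. [folklore] -/
theorem card_support_newCoeff_le {M v Lp Cp Lk Ck : Poly2} {t μ ℓ s : ℕ} (hvt : v.support.card ≤ t) (hμ : M.support.card ≤ μ)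
    (hLp : Lp.support.card ≤ ℓ) (hLk : Lk.support.card ≤ ℓ) (hCp : Cp.support.card ≤ s) (hCk : Ck.support.card ≤ s) :
    (newCoeff M v Lp Cp Lk Ck).support.card ≤ 2 * s * s * (ℓ + μ * t) := by
  unfold newCoeff
  have h1 := (card_supp_mul_le Cp (dCoeff M v Lk Ck)).trans (Nat.mul_le_mul hCp (card_support_dCoeff_le hvt hμ hLk hCk))
  have h2 := (card_supp_mul_le Ck (dCoeff M v Lp Cp)).trans (Nat.mul_le_mul hCk (card_support_dCoeff_le hvt hμ hLp hCp))
  have h3 := card_supp_sub_le (Cp * dCoeff M v Lk Ck) (Ck * dCoeff M v Lp Cp)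
  have e : s * (s * ℓ + μ * (s * t)) + s * (s * ℓ + μ * (s * t)) = 2 * s * s * (ℓ + μ * t) := by ring
  omega

/-! ### §2 The one-step identity -/

/-- `J(Σ Fₖ, v) = Σ J(Fₖ, v)`. [folklore] -/
theorem jac_sum_left {ι : Type*} (K : Finset ι) (F : ι → Poly2) (v : Poly2) :
    jac (∑ k ∈ K, F k) v = ∑ k ∈ K, jac (F k) v := by
  rw [← jacDer_apply, map_sum]
  exact Finset.sum_congr rfl fun k _ => jacDer_apply v (F k)

/-- ★ **ONE-STEP IDENTITY of the unit ladder.** Pivoting `E = Σ_{k∈K} Uₖ·Cₖ` at `p ∈ K` with `G = U_p·C_p`: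
`M·(G·J(E,v) − E·J(G,v)) = U_p · Σ_{k∈K∖p} Uₖ·(C_p·Cₖ′ − Cₖ·C_p′)` — the pivot term cancels identically. [folklore] -/
theorem ladder_step_identity {ι : Type*} (K : Finset ι) (U C L : ι → Poly2) (M v : Poly2) (p : ι) (hp : p ∈ K)
    (hUL : ∀ k ∈ K, M * jac (U k) v = U k * L k) :
    M * (U p * C p * jac (∑ k ∈ K, U k * C k) v - (∑ k ∈ K, U k * C k) * jac (U p * C p) v) =
      U p * ∑ k ∈ K.erase p, U k * newCoeff M v (L p) (C p) (L k) (C k) := by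
  have hd : ∀ k ∈ K, M * jac (U k * C k) v = U k * dCoeff M v (L k) (C k) := fun k hk => unit_jac M v (U k) (L k) (C k) (hUL k hk)
  have hdp := hd p hp
  -- expand both products through the unit rule
  have h1 : M * (U p * C p * jac (∑ k ∈ K, U k * C k) v) = ∑ k ∈ K, U p * C p * (U k * dCoeff M v (L k) (C k)) := by
    rw [jac_sum_left, Finset.mul_sum, Finset.mul_sum]
    refine Finset.sum_congr rfl fun k hk => ?_
    rw [← hd k hk]; ring
  have h2 : M * ((∑ k ∈ K, U k * C k) * jac (U p * C p) v) = ∑ k ∈ K, U k * C k * (U p * dCoeff M v (L p) (C p)) := by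
    rw [← hdp, Finset.sum_mul, Finset.mul_sum]
    refine Finset.sum_congr rfl fun k _ => ?_
    ring
  rw [mul_sub, h1, h2, ← Finset.sum_sub_distrib, ← Finset.add_sum_erase K _ hp, Finset.mul_sum]
  have hzero : U p * C p * (U p * dCoeff M v (L p) (C p)) - U p * C p * (U p * dCoeff M v (L p) (C p)) = 0 := sub_self _
  rw [hzero, zero_add]
  refine Finset.sum_congr rfl fun k _ => ?_
  unfold newCoeff
  ring

/-! ### §3 The ladder: induction on the number of terms -/

/-- ★★ **THE UNIT LADDER.** Fix a chart `σ`, a non-constant `t`-sparse carrier `v`, `M ≠ 0` with `≤ μ` terms, and units `Uₖ ≠ 0` with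
`M·J(Uₖ,v) = Uₖ·Lₖ`, `|supp Lₖ| ≤ ℓ`, `|Eset σ Uₖ| ≤ η`.  Then for every finite family of `≤ n` terms with `s`-sparse coefficients,
`|Eset σ (Σ_{k∈K} Uₖ·Cₖ)| ≤ ladderBound t μ ℓ η n s`. -/
theorem card_Eset_unitSum_le {σ : ℝ} (hσ : σ = 1 ∨ σ = -1) {v M : Poly2} {t μ ℓ η : ℕ} (hv : (S1 v).Nonempty)
    (hvt : v.support.card ≤ t) (hM : M ≠ 0) (hμ : M.support.card ≤ μ) {ι : Type*} (U L : ι → Poly2)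
    (hU : ∀ k, U k ≠ 0) (hUL : ∀ k, M * jac (U k) v = U k * L k) (hL : ∀ k, (L k).support.card ≤ ℓ)
    (hη : ∀ k, (Eset σ (U k)).card ≤ η) :
    ∀ (n : ℕ) (K : Finset ι) (C : ι → Poly2) (s : ℕ), K.card ≤ n → (∀ k ∈ K, (C k).support.card ≤ s) →
      (Eset σ (∑ k ∈ K, U k * C k)).card ≤ ladderBound t μ ℓ η n s
  | 0, K, C, s, hK, _ => by
    have hK0 : K = ∅ := Finset.card_eq_zero.mp (Nat.le_zero.mp hK)
    rw [hK0, Finset.sum_empty, Eset_zero]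
    simp [ladderBound]
  | n + 1, K, C, s, hK, hC => by
    show (Eset σ (∑ k ∈ K, U k * C k)).card ≤ 3 * (t * t + t) + 4 * η + 3 * (s * s) + 2 + ladderBound t μ ℓ η n (2 * s * s * (ℓ + μ * t))
    by_cases hall : ∀ k ∈ K, C k = 0
    · have h0 : ∑ k ∈ K, U k * C k = 0 := Finset.sum_eq_zero fun k hk => by rw [hall k hk, mul_zero]
      rw [h0, Eset_zero]
      simp
    push Not at hall
    obtain ⟨p, hp, hCp⟩ := hall
    have hG : U p * C p ≠ 0 := mul_ne_zero (hU p) hCp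
    have hid := ladder_step_identity K U C L M v p hp (fun k _ => hUL k)
    have hsub := Eset_subset_of_shifted hσ hv hG hM hid
    -- sizes
    have hX : (Xc σ v).card ≤ t * t + t := (card_Xc_le σ v).trans (Nat.add_le_add (Nat.mul_le_mul hvt hvt) hvt)
    have hGE : (Eset σ (U p * C p)).card ≤ η + s * s :=
      (card_Eset_mul_le hσ (U p) (C p)).trans (Nat.add_le_add (hη p) (card_Eset_le_sq σ (C p) (hC p hp)))
    have hSS : (SpecShift σ v (U p * C p) (∑ k ∈ K, U k * C k)).card ≤ 2 * ((t * t + t) + (η + s * s) + 1) :=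
      (card_SpecShift_le' hσ v _ _).trans (by omega)
    have hUp := hη p
    -- the shorter family
    have hK' : (K.erase p).card ≤ n := by rw [Finset.card_erase_of_mem hp]; omega
    have hC' : ∀ k ∈ K.erase p, (newCoeff M v (L p) (C p) (L k) (C k)).support.card ≤ 2 * s * s * (ℓ + μ * t) := fun k hk =>
      card_support_newCoeff_le hvt hμ (hL p) (hL k) (hC p hp) (hC k (Finset.mem_of_mem_erase hk))
    have hnew := card_Eset_unitSum_le hσ hv hvt hM hμ U L hU hUL hL hη n (K.erase p)
      (fun k => newCoeff M v (L p) (C p) (L k) (C k)) (2 * s * s * (ℓ + μ * t)) hK' hC'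
    have hc := (Finset.card_le_card hsub).trans
      ((Finset.card_union_le _ _).trans (Nat.add_le_add
        ((Finset.card_union_le _ _).trans (Nat.add_le_add (Finset.card_union_le _ _) le_rfl))
        (Finset.card_union_le _ _)))
    omega

end Summit.ValiantsHypothesis.ValiantsHypothesis.Theorems.TwoProducts.RankTwoJacobian

end
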